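import Summits.QuantumFields.BalabanUV.T4Continuum.Spine.NE1p.DressedSmallFieldOuterLabelsWitness

/-!
# T⁴ programme, spine estimate NE1′ (node O3b/H2) — WITNESS «THE THIRD AND FOURTH RESUMMATION STEPS FIRE», PART 2 (GENUINE): the
# outer-label activity READS the table and the bounded quantity of N0v's fired END is NOT zero

Cell `pub-balaban`, sub-cell `t4`, row NE1′ formalisation crew (`t4/formal/NE1p/LEAVES.md` row W52 ∕ DAG N29zzw; INTENT HOME/CLAIMS.log l.20025,
BOOKED typer R-T127 l.20102; X170 its read), unit `b2b-balaban-t4-ne1p-formalise-leaf-09` (gen 12); PART 2 of 2 (D1) — imports PART 1 `Spine/NE1p/DressedSmallFieldOuterLabelsWitness`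
ONLY and re-enters its namespace; THEOREMS ONLY (0 def, 0 `def … : Prop`, 0 cite, 0 sorry, 0 `attribute`); nothing of PART 1 ∕ N0v ∕
W50 ∕ W45 ∕ W41 ∕ W35 ∕ W33 ∕ W24 is restated — `termsO`, `cO`, `cO_pos`, `majO`, `majO_pos`, `sum_majO_X₀_le_two`, `GO_apply`, `actO`,
`card_termsO_X₀`, `majO_uncovered`, W41's `termAt_coreW_pencil` ∕ `closedForm_real_sub_zero` ∕ `norm_term_le`, W33's `integral_incr_pos`,
W24's `X₀_val` ∕ `dressedConst_le_one` ∕ `exp_locE_cube`, W50's `coveringFamilies_emptyFootprint` are used BY NAME.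

* §6 `uncovered_mem_termsO` ∕ **`uncoveredTerm_live`** — the large-field label `⟨{0}, ⟨∅, Pi.empty⟩⟩` IS a term of `X₀` and its OWN
  core's term READS the table (increment `(cM r∕2)·vO·∫ incr r ≠ 0`): the `v^{#W′}` fibre is LIVE inside the END; `actO_closedForm` — on EVERY polymer the activity is ONE common W33 integral times the total weight `Σ_{l ∈ termsO Z} cO l`
  (all cores share the read-out `r`; `Finset.sum_mul`); `actO_real_sub_zero`; **`actO_live`** — at `X₀` the three labels' total weight
  is positive (`card_termsO_X₀ = 3`, `cO > 0`) and W33's `∫ incr r > 0`: the attached part of the activity is NOT zero;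
  `norm_actO_X₀_lt_one` (`Σ majO ≤ 2` by PART 1's closed form, W41's `norm_term_le`, `A ≤ 1`, `√π < √(2π)`);
  **`outerEnd_live`** — the END's bounded quantity is NOT zero (W24's `exp_locE_cube` BY NAME).

HONEST FRAMING.  A DECIDED TOY ([folklore]); as PART 1: nothing asserted about Bałaban's densities; 0 binders instantiated on Bałaban's
densities; no wall item; wall v1.7 (T4-DAG v46) does NOT move; R-t4r2-Q2 NOT met; NE1′ ⇐ the named binders — NOT proved, NOT printed;
spine PROVED 0∕9; count 9 unchanged.  Rung (B)+1 on ONE finite four-torus — NOT infinite volume, NOT a mass gap, NOT OS on ℝ⁴, NOT Clay.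
HONEST DEPENDENCY: continuum YM on T⁴ ⇐ BetaPertH ∧ nine spine estimates (0/9 proved); BetaPertH ⇐ (D1) ∧ (D4) ∧ CAP+tail; G-an2-4
gates asym, D1 and NE2/3/4.
-/

noncomputable section

namespace Summit.QuantumFields.BalabanUV.T4Continuum.NE1p.DressedSmallFieldOuterLabelsWitness

open Set Metric MeasureTheory Complex
open scoped BigOperators
open Literature.MathematicalPhysics.QuantumFieldTheory.Balaban1983to89
open Literature.MathematicalPhysics.QuantumFieldTheory.Balaban1983to89.B13Resummation (locE)
open Literature.MathematicalPhysics.QuantumFieldTheory.Balaban1983to89.TreeLengthTorus (TPt TDom tsys)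
open Literature.MathematicalPhysics.QuantumFieldTheory.Balaban1983to89.TreeLengthTorusGeometry (tgeometry TTouch)
open Summit.QuantumFields.BalabanUV.T4Continuum.B13HistMeasurable (B13HistM)
open Summit.QuantumFields.BalabanUV.T4Continuum.B13HistWitness (toyFrame)
open Summit.QuantumFields.BalabanUV.T4Continuum.B13TermParamGaussianBi (BiCore)
open Summit.QuantumFields.BalabanUV.T4Continuum.NE1p.DressedSmallFieldTorusWitness (X₀ X₀_val dressedConst_le_one exp_locE_cube)
open Summit.QuantumFields.BalabanUV.T4Continuum.NE1p.DressedSmallFieldCoresWitness (E1 crd liveTable Acst Acst_pos incr integral_incr_pos)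
open Summit.QuantumFields.BalabanUV.T4Continuum.NE1p.DressedSmallFieldCoresMassWitness (cM cM_pos)
open Summit.QuantumFields.BalabanUV.T4Continuum.NE1p.DressedSmallFieldDepCoresWitness (termAt_coreW_pencil closedForm_real_sub_zero
  norm_term_le)
open Summit.QuantumFields.BalabanUV.T4Continuum.NE1p.DressedSmallFieldInnerLabelsWitness (coveringFamilies_emptyFootprint)
open Literature.MathematicalPhysics.QuantumFieldTheory.Balaban1983to89.B13FamilySum (coveringFamilies mem_coveringFamilies)

section Torus
variable (N : ℕ) [NeZero N] (r : ℝ) (hr : 0 ≤ r)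

/-! ## §6 GENUINE: the activity in closed form on every polymer; at `X₀` it is LIVE, and the END's quantity is NOT zero -/

open Classical in
/-- The LARGE-FIELD label `⟨{0}, ⟨∅, Pi.empty⟩⟩` IS a term of `X₀` (`W′ = {0}` — the whole cube uncovered; the empty family covers
`{0} ∖ {0} = ∅`, W50's `coveringFamilies_emptyFootprint`; the empty choice). [folklore] -/
theorem uncovered_mem_termsO : (⟨{0}, ⟨∅, Finset.Pi.empty _⟩⟩ : OLabel N) ∈ termsO N (X₀ N) := by
  rw [mem_termsO_iff]
  refine ⟨by simp [X₀_val], ?_, fun Z' h => absurd h (Finset.notMem_empty _)⟩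
  rw [show (tgeometry 4 N).cubes (X₀ N) \ ({0} : Finset (TPt 4 N)) = ∅ by simp [X₀_val]]
  rw [coveringFamilies_emptyFootprint]
  exact Finset.mem_singleton_self _

/-- **THE LARGE-FIELD LABEL's OWN TERM READS THE TABLE** [decided toy]: its core's term at the source `1` differs from the one at `0` —
the increment is `(cM r∕2)·vO·∫ incr r ≠ 0` (`majO_uncovered`, W33's `integral_incr_pos`): the `v^{#W′}` fibre of N0v's count is LIVE
inside the END (at `v := 0` it would be dead). [folklore] -/
theorem uncoveredTerm_live (hr0 : 0 < r) (k : ℕ) :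
    (GO N r hr k ⟨{0}, ⟨∅, Finset.Pi.empty _⟩⟩ k).termAt (0 : ℂ) ((0 : B13HistM toyFrame) + (1 : ℂ) • liveTable) ≠
      (GO N r hr k ⟨{0}, ⟨∅, Finset.Pi.empty _⟩⟩ k).termAt (0 : ℂ) ((0 : B13HistM toyFrame) + (0 : ℂ) • liveTable) := by
  intro h
  have h0 := sub_eq_zero.2 h
  rw [GO_apply, termAt_coreW_pencil, termAt_coreW_pencil, show (1 : ℂ) = ((1 : ℝ) : ℂ) from Complex.ofReal_one.symm,
    closedForm_real_sub_zero _ r hr 1, one_mul] at h0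
  rcases mul_eq_zero.1 h0 with hc | hI
  · exact (cO_pos N r _).ne' (by exact_mod_cast hc)
  · exact (integral_incr_pos r hr0).ne' (by exact_mod_cast hI)

open Classical in
/-- **THE ACTIVITY IN CLOSED FORM ON EVERY POLYMER**: all outer-label cores share W33's read-out, so
`actO k s Z = (Σ_{l ∈ termsO Z} cO l)·∫ e^{s·r·e^{−(v 0)²}}·e^{−‖v‖²} dv` (W41's `termAt_coreW_pencil` BY NAME, `Finset.sum_mul`). [folklore] -/
theorem actO_closedForm (k : ℕ) (s : ℂ) (Z : TDom 4 N) :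
    actO N r hr k s Z =
      ((∑ l ∈ termsO N Z, cO N r l : ℝ) : ℂ) *
        ∫ v : E1, cexp (s * ((r : ℂ) * (Real.exp (-(crd v ^ 2)) : ℂ))) * cexp (-(((‖v‖ ^ 2 : ℝ) : ℂ))) := by
  unfold actO
  simp only [GO_apply, termAt_coreW_pencil]
  rw [← Finset.sum_mul]
  push_cast
  rfl

/-- The increment between a REAL source `t` and `0` on a polymer: `(Σ_l cO l)·∫ incr (t·r)` (W41's `closedForm_real_sub_zero`). [folklore] -/
theorem actO_real_sub_zero (k : ℕ) (t : ℝ) (Z : TDom 4 N) :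
    actO N r hr k (t : ℂ) Z - actO N r hr k 0 Z = ((∑ l ∈ termsO N Z, cO N r l : ℝ) : ℂ) * ((∫ v, incr (t * r) v : ℝ) : ℂ) := by
  rw [actO_closedForm, actO_closedForm]
  exact closedForm_real_sub_zero _ r hr t

open Classical in
/-- **THE TOTAL WEIGHT AT THE UNIT CUBE IS POSITIVE**: three labels (`card_termsO_X₀ = 3`), each of positive weight. [arith] -/
theorem sum_cO_X₀_pos : 0 < ∑ l ∈ termsO N (X₀ N), cO N r l := by
  refine Finset.sum_pos (fun l _ => cO_pos N r l) ?_
  rw [← Finset.card_pos, card_termsO_X₀]; norm_num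

/-- **THE ATTACHED PART OF THE ACTIVITY IS NOT ZERO** [decided toy]: positive total weight and W33's `∫ incr r > 0` for `0 < r` —
the large-field fibre and both configurations of the covered fibre READ the table. [folklore] -/
theorem actO_live (hr0 : 0 < r) (k : ℕ) : actO N r hr k 1 (X₀ N) ≠ actO N r hr k 0 (X₀ N) := by
  intro h
  have h0 := sub_eq_zero.2 h
  rw [show (1 : ℂ) = ((1 : ℝ) : ℂ) from Complex.ofReal_one.symm, actO_real_sub_zero, one_mul] at h0
  rcases mul_eq_zero.1 h0 with hc | hI
  · exact (sum_cO_X₀_pos N r).ne' (by exact_mod_cast hc)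
  · exact (integral_incr_pos r hr0).ne' (by exact_mod_cast hI)

open Classical in
/-- The activities at `X₀` lie STRICTLY inside the unit disc for `‖s‖ ≤ 2`: `Σ_l cO l = (Σ_l majO l)·(cM r∕2)` with `Σ_l majO l ≤ 2`
(PART 1's closed form), W41's `norm_term_le`, `A ≤ 1`, `√π < √(2π)`. [folklore] -/
theorem norm_actO_X₀_lt_one (k : ℕ) {s : ℂ} (hs : ‖s‖ ≤ 2) : ‖actO N r hr k s (X₀ N)‖ < 1 := by
  rw [actO_closedForm]
  set m : ℝ := ∑ l ∈ termsO N (X₀ N), majO N l with hm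
  have hm0 : 0 ≤ m := Finset.sum_nonneg fun l _ => (majO_pos N l).le
  have hm2 : m ≤ 2 := sum_majO_X₀_le_two N
  have hsum : ∑ l ∈ termsO N (X₀ N), cO N r l = m * (cM r / 2) := by
    rw [hm, Finset.sum_mul]; exact Finset.sum_congr rfl fun l _ => by unfold cO; ring
  have hπ : 0 < Real.sqrt Real.pi := Real.sqrt_pos.2 Real.pi_pos
  have hlt : Real.sqrt Real.pi < Real.sqrt (2 * Real.pi) := Real.sqrt_lt_sqrt Real.pi_pos.le (by linarith [Real.pi_pos])
  have hq : Real.sqrt Real.pi / Real.sqrt (2 * Real.pi) < 1 := (div_lt_one (hπ.trans hlt)).2 hlt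
  have hq0 : 0 ≤ Real.sqrt Real.pi / Real.sqrt (2 * Real.pi) := by positivity
  have hA : Acst ≤ 1 := dressedConst_le_one
  have hb := norm_term_le r hr hs
  have hn : ‖((∑ l ∈ termsO N (X₀ N), cO N r l : ℝ) : ℂ) *
        ∫ v : E1, cexp (s * ((r : ℂ) * (Real.exp (-(crd v ^ 2)) : ℂ))) * cexp (-(((‖v‖ ^ 2 : ℝ) : ℂ)))‖ =
      m * ‖((cM r / 2 : ℝ) : ℂ) * ∫ v : E1, cexp (s * ((r : ℂ) * (Real.exp (-(crd v ^ 2)) : ℂ))) *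
        cexp (-(((‖v‖ ^ 2 : ℝ) : ℂ)))‖ := by
    rw [hsum, norm_mul, norm_mul, Complex.norm_real, Complex.norm_real, Real.norm_eq_abs, Real.norm_eq_abs, abs_mul,
      abs_of_nonneg hm0]
    ring
  rw [hn]
  calc m * ‖((cM r / 2 : ℝ) : ℂ) * ∫ v : E1, cexp (s * ((r : ℂ) * (Real.exp (-(crd v ^ 2)) : ℂ))) *
          cexp (-(((‖v‖ ^ 2 : ℝ) : ℂ)))‖
      ≤ 2 * (Acst / 2 * (Real.sqrt Real.pi / Real.sqrt (2 * Real.pi))) := mul_le_mul hm2 hb (norm_nonneg _) zero_le_two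
    _ = Acst * (Real.sqrt Real.pi / Real.sqrt (2 * Real.pi)) := by ring
    _ < 1 := by
        have := Acst_pos
        nlinarith

open Classical in
/-- **THE END's BOUNDED QUANTITY IS NOT ZERO** [decided toy]: equal dressed outputs on the cube would give equal activities at `X₀`
(W24's `exp_locE_cube` BY NAME), contradicting `actO_live`. [folklore] -/
theorem outerEnd_live (hr0 : 0 < r) (k : ℕ) :
    locE (tgeometry 4 N).ι (tgeometry 4 N).cubes (actO N r hr k 1) ((tgeometry 4 N).cubes (X₀ N)) ≠
      locE (tgeometry 4 N).ι (tgeometry 4 N).cubes (actO N r hr k 0) ((tgeometry 4 N).cubes (X₀ N)) := by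
  intro h
  have h1 := exp_locE_cube N (w := actO N r hr k 1) (norm_actO_X₀_lt_one N r hr k (by simp))
  have h0 := exp_locE_cube N (w := actO N r hr k 0) (norm_actO_X₀_lt_one N r hr k (by simp))
  have h' : cexp (locE (TTouch (d := 4) (N := N)) (fun Z : (tsys 4 N).Dom => Z.1) (actO N r hr k 1) {0}) =
      cexp (locE (TTouch (d := 4) (N := N)) (fun Z : (tsys 4 N).Dom => Z.1) (actO N r hr k 0) {0}) := congrArg cexp h
  rw [h1, h0, add_right_inj] at h'
  exact actO_live N r hr hr0 k h'

end Torus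

end Summit.QuantumFields.BalabanUV.T4Continuum.NE1p.DressedSmallFieldOuterLabelsWitness

end
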